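import Literature.MathematicalPhysics.KineticTheory.LangevinChainExpMartingale

/-!
# Itô–Riemann sums along the nodes of a scheme (deterministic limit theorem; K3 helper)

Helper file for stub `stub_antiDampedGirsanov` (K3) of line `lebesgue-flip-duality`, crux ★
`BondHeatUncertainty.LinearResponseFTUR` (stmt-AtomisticToContinuum-9122). The logarithm of the
discrete Cameron–Martin density between the damped and the anti-damped splitting schemes is a sum
`Σ_k p_b(z_k) ΔB_k` of a bath momentum AT THE SCHEME NODES against the Brownian increments (plus a
Riemann sum). Its limit along the dyadic meshes is identified here PATH BY PATH, with the only
probabilistic input isolated as a hypothesis (the dyadic quadratic variation `Σ_k (ΔB_k)² → t`, true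
almost surely: `Literature.Probability.Process.ae_tendsto_brownianQuadSum_dyadic`):

* `tendsto_itoSum_of_nodes` — if the node values have the form `α^m_k + κ B(k h_m)` (`h_m = t/2^m`)
  where the "smooth part" `α^m` has increments over each cell within `h_m δ_m` (`δ_m → 0`) of the cell
  integrals of a continuous `g`, `α^m_{2^m} → a₀ + ∫₀ᵗ g`, and `B` is continuous with `B(0) = 0`, then
  `Σ_{k<2^m} (α^m_k + κ B(k h_m)) (B((k+1)h_m) - B(k h_m)) → (a₀ + ∫₀ᵗ g) B(t) - ∫₀ᵗ B g + (κ/2)(B(t)² - t)`.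
  Proof: summation by parts for the smooth part (the increments of `α^m` are `O(h)`, so the sum is a
  tagged Riemann–Stieltjes sum, `tendsto_sum_mul_integral_of_continuous` of the tree) and the algebraic
  identity `Σ B_k ΔB_k = (B(t)² - Σ(ΔB_k)²)/2` for the rough part (`sum_mul_sub_self_eq`).

Pure real analysis; nothing is specific to the chain.
-/

noncomputable section

namespace Summit.AtomisticToContinuum.FouriersLaw.Theorems.LinearResponseFTUR

open MeasureTheory Filter Set Function Finset intervalIntegral Topology
open Literature.MathematicalPhysics.KineticTheory.HeatConduction

/-- `2^m → ∞`. -/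
theorem tendsto_two_pow_atTop : Tendsto (fun m : ℕ => 2 ^ m) atTop atTop :=
  tendsto_pow_atTop_atTop_of_one_lt one_lt_two

/-- The mesh closes up exactly: `2^m · (t / 2^m) = t`. -/
theorem two_pow_mul_div (t : ℝ) (m : ℕ) : (2 : ℝ) ^ m * (t / 2 ^ m) = t :=
  mul_div_cancel₀ _ (pow_ne_zero _ two_ne_zero)

/-- **Itô–Riemann sums along scheme nodes converge** (see the module docstring). -/
theorem tendsto_itoSum_of_nodes {t : ℝ} (ht : 0 ≤ t) {B g : ℝ → ℝ} (hB : Continuous B) (hB0 : B 0 = 0)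
    (hg : Continuous g) (a₀ κ : ℝ) (α : ℕ → ℕ → ℝ) (δ : ℕ → ℝ) (hδ : Tendsto δ atTop (𝓝 0))
    (hαM : Tendsto (fun m : ℕ => α m (2 ^ m)) atTop (𝓝 (a₀ + ∫ u in (0 : ℝ)..t, g u)))
    (hstep : ∀ m k : ℕ, k < 2 ^ m →
      |(α m (k + 1) - α m k) - ∫ u in ((k : ℝ) * (t / 2 ^ m))..(((k : ℝ) + 1) * (t / 2 ^ m)), g u| ≤
        (t / 2 ^ m) * δ m)
    (hQV : Tendsto (fun m : ℕ => ∑ k ∈ range (2 ^ m),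
      (B (((k : ℝ) + 1) * (t / 2 ^ m)) - B ((k : ℝ) * (t / 2 ^ m))) ^ 2) atTop (𝓝 t)) :
    Tendsto (fun m : ℕ => ∑ k ∈ range (2 ^ m),
        (α m k + κ * B ((k : ℝ) * (t / 2 ^ m))) * (B (((k : ℝ) + 1) * (t / 2 ^ m)) - B ((k : ℝ) * (t / 2 ^ m))))
      atTop (𝓝 ((a₀ + ∫ u in (0 : ℝ)..t, g u) * B t - (∫ u in (0 : ℝ)..t, B u * g u) +
        κ / 2 * (B t ^ 2 - t))) := by
  -- notation per mesh
  have hmesh : ∀ m : ℕ, ((2 ^ m : ℕ) : ℝ) * (t / 2 ^ m) = t := fun m => by push_cast; exact two_pow_mul_div t m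
  -- split the sum into the smooth part and the rough part
  have hsplit : ∀ m : ℕ, ∑ k ∈ range (2 ^ m),
      (α m k + κ * B ((k : ℝ) * (t / 2 ^ m))) * (B (((k : ℝ) + 1) * (t / 2 ^ m)) - B ((k : ℝ) * (t / 2 ^ m))) =
      (∑ k ∈ range (2 ^ m), α m k * (B (((k : ℝ) + 1) * (t / 2 ^ m)) - B ((k : ℝ) * (t / 2 ^ m)))) +
        κ * ∑ k ∈ range (2 ^ m), B ((k : ℝ) * (t / 2 ^ m)) *
          (B (((k : ℝ) + 1) * (t / 2 ^ m)) - B ((k : ℝ) * (t / 2 ^ m))) := by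
    intro m
    rw [mul_sum, ← sum_add_distrib]
    refine sum_congr rfl fun k _ => ?_
    ring
  simp_rw [hsplit]
  refine Tendsto.add ?_ ?_
  · ----------------------------------------------------------------
    -- smooth part: summation by parts
    ----------------------------------------------------------------
    have habel : ∀ m : ℕ, ∑ k ∈ range (2 ^ m), α m k * (B (((k : ℝ) + 1) * (t / 2 ^ m)) - B ((k : ℝ) * (t / 2 ^ m))) =
        α m (2 ^ m) * B t - ∑ k ∈ range (2 ^ m), B (((k : ℝ) + 1) * (t / 2 ^ m)) * (α m (k + 1) - α m k) := by
      intro m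
      have h := sum_mul_sub_eq_abel (α m) (fun k : ℕ => B ((k : ℝ) * (t / 2 ^ m))) (2 ^ m)
      simp only [Nat.cast_zero, zero_mul, hB0, mul_zero, sub_zero] at h
      rw [hmesh m] at h
      simp only [Nat.cast_succ] at h
      exact h
    simp_rw [habel]
    refine (hαM.mul tendsto_const_nhds).sub ?_
    -- the Stieltjes sum: replace the increments of `α` by the cell integrals of `g`
    have hRS := tendsto_sum_mul_integral_of_continuous hB hg ht (fun n k => ((k : ℝ) + 1) * (t / n))
      fun n k _ => ⟨by nlinarith [div_nonneg ht n.cast_nonneg], le_rfl⟩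
    have hRS2 := hRS.comp tendsto_two_pow_atTop
    -- the error
    obtain ⟨C, hC⟩ := isCompact_Icc.exists_bound_of_continuousOn (hB.continuousOn (s := Icc 0 t))
    have hC0 : 0 ≤ C := (norm_nonneg _).trans (hC 0 ⟨le_rfl, ht⟩)
    have herr : Tendsto (fun m : ℕ => ∑ k ∈ range (2 ^ m), B (((k : ℝ) + 1) * (t / 2 ^ m)) *
        ((α m (k + 1) - α m k) - ∫ u in ((k : ℝ) * (t / 2 ^ m))..(((k : ℝ) + 1) * (t / 2 ^ m)), g u))
        atTop (𝓝 0) := by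
      have hbd : ∀ m : ℕ, |∑ k ∈ range (2 ^ m), B (((k : ℝ) + 1) * (t / 2 ^ m)) *
          ((α m (k + 1) - α m k) - ∫ u in ((k : ℝ) * (t / 2 ^ m))..(((k : ℝ) + 1) * (t / 2 ^ m)), g u)| ≤
          C * t * |δ m| := by
        intro m
        refine (abs_sum_le_sum_abs _ _).trans ?_
        calc ∑ k ∈ range (2 ^ m), |B (((k : ℝ) + 1) * (t / 2 ^ m)) *
              ((α m (k + 1) - α m k) - ∫ u in ((k : ℝ) * (t / 2 ^ m))..(((k : ℝ) + 1) * (t / 2 ^ m)), g u)|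
            ≤ ∑ k ∈ range (2 ^ m), C * ((t / 2 ^ m) * |δ m|) := by
              refine sum_le_sum fun k hk => ?_
              have hk' : k < 2 ^ m := mem_range.1 hk
              rw [abs_mul]
              refine mul_le_mul ?_ ((hstep m k hk').trans ?_) (abs_nonneg _) hC0
              · have hmem : ((k : ℝ) + 1) * (t / 2 ^ m) ∈ Icc (0 : ℝ) t := by
                  refine ⟨by positivity, ?_⟩
                  have : ((k : ℝ) + 1) ≤ 2 ^ m := by exact_mod_cast hk'
                  calc ((k : ℝ) + 1) * (t / 2 ^ m) ≤ 2 ^ m * (t / 2 ^ m) :=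
                        mul_le_mul_of_nonneg_right this (by positivity)
                    _ = t := two_pow_mul_div t m
                simpa [Real.norm_eq_abs] using hC _ hmem
              · exact mul_le_mul_of_nonneg_left (le_abs_self _) (by positivity)
          _ = C * t * |δ m| := by
              rw [sum_const, card_range, nsmul_eq_mul]
              push_cast
              field_simp
      have hlim : Tendsto (fun m : ℕ => C * t * |δ m|) atTop (𝓝 0) := by
        have := (continuous_abs.tendsto 0).comp hδ
        simpa using this.const_mul (C * t)
      exact squeeze_zero_norm' (Eventually.of_forall fun m => by simpa [Real.norm_eq_abs] using hbd m) hlim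
    have hsum : ∀ m : ℕ, ∑ k ∈ range (2 ^ m), B (((k : ℝ) + 1) * (t / 2 ^ m)) * (α m (k + 1) - α m k) =
        (∑ k ∈ range (2 ^ m), B (((k : ℝ) + 1) * (t / 2 ^ m)) *
            ∫ u in ((k : ℝ) * (t / 2 ^ m))..(((k : ℝ) + 1) * (t / 2 ^ m)), g u) +
          ∑ k ∈ range (2 ^ m), B (((k : ℝ) + 1) * (t / 2 ^ m)) *
            ((α m (k + 1) - α m k) - ∫ u in ((k : ℝ) * (t / 2 ^ m))..(((k : ℝ) + 1) * (t / 2 ^ m)), g u) := by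
      intro m
      rw [← sum_add_distrib]
      refine sum_congr rfl fun k _ => ?_
      ring
    simp_rw [hsum]
    have h2 : Tendsto (fun m : ℕ => ∑ k ∈ range (2 ^ m), B (((k : ℝ) + 1) * (t / 2 ^ m)) *
        ∫ u in ((k : ℝ) * (t / 2 ^ m))..(((k : ℝ) + 1) * (t / 2 ^ m)), g u) atTop
        (𝓝 (∫ u in (0 : ℝ)..t, B u * g u)) := by
      refine hRS2.congr fun m => ?_
      simp only [Function.comp_apply, Nat.cast_pow, Nat.cast_ofNat]
    simpa using h2.add herr
  · ----------------------------------------------------------------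
    -- rough part: `Σ B_k ΔB_k = (B(t)² - Σ(ΔB)²)/2`
    ----------------------------------------------------------------
    have hself : ∀ m : ℕ, ∑ k ∈ range (2 ^ m), B ((k : ℝ) * (t / 2 ^ m)) *
        (B (((k : ℝ) + 1) * (t / 2 ^ m)) - B ((k : ℝ) * (t / 2 ^ m))) =
        (B t ^ 2 - ∑ k ∈ range (2 ^ m), (B (((k : ℝ) + 1) * (t / 2 ^ m)) - B ((k : ℝ) * (t / 2 ^ m))) ^ 2) / 2 := by
      intro m
      have h := sum_mul_sub_self_eq (fun k : ℕ => B ((k : ℝ) * (t / 2 ^ m))) (2 ^ m)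
      simp only [Nat.cast_zero, zero_mul, hB0] at h
      rw [hmesh m] at h
      simp only [Nat.cast_succ, ne_eq, OfNat.ofNat_ne_zero, not_false_eq_true, zero_pow, sub_zero] at h
      exact h
    simp_rw [hself]
    have : Tendsto (fun m : ℕ => κ * ((B t ^ 2 - ∑ k ∈ range (2 ^ m),
        (B (((k : ℝ) + 1) * (t / 2 ^ m)) - B ((k : ℝ) * (t / 2 ^ m))) ^ 2) / 2)) atTop
        (𝓝 (κ * ((B t ^ 2 - t) / 2))) :=
      ((tendsto_const_nhds.sub hQV).div_const 2).const_mul κ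
    refine this.congr' (Eventually.of_forall fun m => rfl) |>.trans ?_
    rw [show κ * ((B t ^ 2 - t) / 2) = κ / 2 * (B t ^ 2 - t) by ring]

/-- **Itô–Riemann sums along scheme nodes converge** — `∀`-form of `tendsto_itoSum_of_nodes`
(registered sub-goal of the crux item). -/
theorem itoSum_of_nodes_limit :
    ∀ (t : ℝ), 0 ≤ t → ∀ (B g : ℝ → ℝ), Continuous B → B 0 = 0 → Continuous g → ∀ (a₀ κ : ℝ) (α : ℕ → ℕ → ℝ) (δ : ℕ → ℝ), Tendsto δ atTop (𝓝 0) → Tendsto (fun m : ℕ => α m (2 ^ m)) atTop (𝓝 (a₀ + ∫ u in (0 : ℝ)..t, g u)) → (∀ m k : ℕ, k < 2 ^ m → |(α m (k + 1) - α m k) - ∫ u in ((k : ℝ) * (t / 2 ^ m))..(((k : ℝ) + 1) * (t / 2 ^ m)), g u| ≤ (t / 2 ^ m) * δ m) → Tendsto (fun m : ℕ => ∑ k ∈ range (2 ^ m), (B (((k : ℝ) + 1) * (t / 2 ^ m)) - B ((k : ℝ) * (t / 2 ^ m))) ^ 2) atTop (𝓝 t) → Tendsto (fun m : ℕ => ∑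 k ∈ range (2 ^ m), (α m k + κ * B ((k : ℝ) * (t / 2 ^ m))) * (B (((k : ℝ) + 1) * (t / 2 ^ m)) - B ((k : ℝ) * (t / 2 ^ m)))) atTop (𝓝 ((a₀ + ∫ u in (0 : ℝ)..t, g u) * B t - (∫ u in (0 : ℝ)..t, B u * g u) + κ / 2 * (B t ^ 2 - t))) :=
  fun _ ht _ _ hB hB0 hg a₀ κ α δ hδ hαM hstep hQV =>
    tendsto_itoSum_of_nodes ht hB hB0 hg a₀ κ α δ hδ hαM hstep hQV

end Summit.AtomisticToContinuum.FouriersLaw.Theorems.LinearResponseFTUR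

end
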